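import Summits.AtomisticToContinuum.Crystallization.Theorems.ContactSaturationLadderSparseCutB

/-!
# ContactSaturationLadderSparseCut — PART C (lines 351–477 of lens-1 g34 `land/ContactSaturationLadderSparseCut.lean`,
# sha256 8eb9f06912371e8673d477c2e909aad4937de9a4938ece956412bf513fe78345; split at the section-header boundaries for the 400-line rule, ONE namespace, linear import chain A → B → C;
# landed by prover hand 1, gen 11, --supports stmt-AtomisticToContinuum-30303: declarations byte-identical, one gate-forced delta = docstrings
# added to the undocumented weaker-by-name / monotonicity lemmas)

§45.3 — the coordination marker `coordMarker m` and its ladder; §45.4 the exact cut of NLC_F(1); §45.5 `ShellSumBound` and `shellSumBound_crude`.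
-/

noncomputable section

namespace Summit.AtomisticToContinuum.Crystallization.Theorems.ContactSaturationLadderSparseCut

section SparseCut45


open scoped BigOperators Classical
open Metric Filter
open Literature.MathematicalPhysics.StatisticalMechanics (lennardJones IsGroundState interactionEnergy groundStateEnergy
  groundStateEnergy_lennardJones_le subadditive_groundStateEnergy_lennardJones sum_inv_pow_six_le)
open Summit.AtomisticToContinuum.Crystallization.Theorems.ContactSaturationLadderHaloCount (voidAdjSet)
open Summit.AtomisticToContinuum.Crystallization.Theorems.ContactSaturationLadderChunkDoor (NoLooseChunks SiteMarker gs_separated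
  seven_tenths_le_gsMinDist cube_le_eight_mul_card_of_voidFree)
open Summit.AtomisticToContinuum.Crystallization.Theorems.ContactSaturationLadderToleranceFloor (UniformlyTightF looseSetF NoLooseChunkAtF
  NoLooseChunksF BandChunkAtF BandExclusionF bandExclusionF_of_noLooseChunksF noLooseChunksF_mono noLooseChunksF_of_noLooseChunks
  looseSetF_anti_slack noLooseChunksF_iff_band noLooseChunksF_of_band)
open Summit.AtomisticToContinuum.Crystallization.Theorems.CrystalliteDichotomyCutPasteLaw (pairSum_add_two_mul_cross_le_groundStateEnergy)

/-! ### §45.3 The coordination marker at the floor contact radius `7/5 = 2·(7/10)` and its ladder -/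

/-- **`coordMarker m`** — the particles with AT LEAST `m` other particles within the floor contact radius `7/5`. The complement of
`coordMarker 12` is «not twelve-coordinated at radius `(1+1)·(7/10)`», the per-particle reading of 1-looseness at the floor scale. -/
def coordMarker (m : ℕ) : SiteMarker := fun N y =>
  Finset.univ.filter fun k : Fin N => m ≤ (Finset.univ.filter fun l : Fin N => l ≠ k ∧ dist (y l) (y k) ≤ 7 / 5).card

/-- The coordination marker is antitone in `m`: `m ≤ m' ⟹ coordMarker m' ⊆ coordMarker m`. [folklore] -/
theorem coordMarker_anti {m m' : ℕ} (h : m ≤ m') (N : ℕ) (y : Fin N → EuclideanSpace ℝ (Fin 3)) :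
    coordMarker m' N y ⊆ coordMarker m N y := by
  intro k hk
  simp only [coordMarker, Finset.mem_filter, Finset.mem_univ, true_and] at hk ⊢
  exact h.trans hk

/-- `coordMarker 0` marks every particle. [folklore] -/
theorem coordMarker_zero (N : ℕ) (y : Fin N → EuclideanSpace ℝ (Fin 3)) : coordMarker 0 N y = Finset.univ := by
  ext k
  simp [coordMarker]


/-- Membership in the coordination marker. -/
theorem mem_coordMarker_iff {m N : ℕ} {y : Fin N → EuclideanSpace ℝ (Fin 3)} {k : Fin N} :
    k ∈ coordMarker m N y ↔ m ≤ (Finset.univ.filter fun l : Fin N => l ≠ k ∧ dist (y l) (y k) ≤ 7 / 5).card := by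
  simp [coordMarker]

/-- **«≤ 11 within 7/5» IS 1-looseness at the floor scale**: in a Lennard-Jones ground state (separation `≥ 7/10`, tree), a particle is uniformly
1-tightF at the floor scale `d = 7/10` iff EVERY particle of its 5-ball has at least twelve others within `7/5 = (1+1)·(7/10)`, i.e. lies in `coordMarker 12`. -/
theorem uniformlyTightF_one_floor_iff {N : ℕ} {y : Fin N → EuclideanSpace ℝ (Fin 3)} (hy : IsGroundState lennardJones y) (j : Fin N) :
    UniformlyTightF 1 (7 / 10) y j ↔ ∀ k : Fin N, dist (y k) (y j) ≤ 5 → k ∈ coordMarker 12 N y := by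
  have h75 : ((1 : ℝ) + 1) * (7 / 10) = 7 / 5 := by norm_num
  constructor
  · rintro ⟨-, -, -, hco⟩ k hk
    rw [mem_coordMarker_iff, ← h75]
    exact hco k hk
  · intro h
    refine ⟨le_rfl, by norm_num, fun k l hkl _ _ => seven_tenths_le_gsMinDist.trans (gs_separated hy k l hkl), fun k hk => ?_⟩
    rw [h75, ← mem_coordMarker_iff]
    exact h k hk

/-- Hence: if every particle of the 5-ball of `j` is twelve-coordinated at radius `7/5`, then `j` is NOT 1-looseF. -/
theorem not_mem_looseSetF_one_of_coordMarker {N : ℕ} {y : Fin N → EuclideanSpace ℝ (Fin 3)} (hy : IsGroundState lennardJones y)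
    {j : Fin N} (h : ∀ k : Fin N, dist (y k) (y j) ≤ 5 → k ∈ coordMarker 12 N y) : j ∉ looseSetF 1 y := by
  simp only [looseSetF, Finset.mem_filter, Finset.mem_univ, true_and, not_forall, not_not]
  exact ⟨7 / 10, (uniformlyTightF_one_floor_iff hy j).mpr h⟩

/-- **SPARSE(m;δ)** := `UnmarkedChunkExclusionF (coordMarker m) δ` — «no large all-`δ`-looseF void-free ground-state chunks in which EVERY
particle has at most `m − 1` others within `7/5`»; it is ANTITONE in `m` (a larger `m` excludes a larger class). -/
theorem sparse_anti {m m' : ℕ} (h : m ≤ m') {δ : ℝ} (hS : UnmarkedChunkExclusionF (coordMarker m') δ) :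
    UnmarkedChunkExclusionF (coordMarker m) δ :=
  unmarkedChunkExclusionF_mono_marker (coordMarker_anti h) hS

/-- **COMARKED(m;δ₁,δ₂)** := `CoMarkedBandExclusionF (coordMarker m) δ₁ δ₂` — «no large all-`δ₁`-looseF void-free ground-state chunks in
which both the `δ₂`-tightF particles and the particles with `≥ m` others within `7/5` are dense»; MONOTONE in `m`. -/
theorem comarked_mono {m m' : ℕ} (h : m ≤ m') {δ₁ δ₂ : ℝ} (hC : CoMarkedBandExclusionF (coordMarker m) δ₁ δ₂) :
    CoMarkedBandExclusionF (coordMarker m') δ₁ δ₂ :=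
  coMarkedBandExclusionF_anti_marker (coordMarker_anti h) hC

/-- **The bottom of the SPARSE ladder is a theorem**: SPARSE(0;δ) at every radius (the marker `coordMarker 0` is everything). -/
theorem unmarkedChunkAt_coord_zero (r : ℝ) : UnmarkedChunkAt (coordMarker 0) r := by
  intro N y hy c hv hF i
  by_contra hin
  rw [not_lt] at hin
  have h2 : dist (y i) c ≤ 2 * r := by
    have : 0 ≤ dist (y i) c := dist_nonneg
    linarith
  exact hF i h2 (by rw [coordMarker_zero]; exact Finset.mem_univ i)

/-- SPARSE at `m = 0` is trivial: `UnmarkedChunkExclusionF (coordMarker 0) δ` for every `δ`. [folklore] -/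
theorem sparse_zero (δ : ℝ) : UnmarkedChunkExclusionF (coordMarker 0) δ :=
  ⟨0, fun r _ => unmarkedChunkAtF_of_unmarkedChunkAt _ δ (unmarkedChunkAt_coord_zero r)⟩

/-- **The top of the COMARKED ladder is BAND itself**: COMARKED(0;δ₁,δ₂) ⟺ BAND_F(δ₁,δ₂) (the marker `coordMarker 0` is everything, so its
density clause is free). -/
theorem comarked_zero_iff (δ₁ δ₂ : ℝ) : CoMarkedBandExclusionF (coordMarker 0) δ₁ δ₂ ↔ BandExclusionF δ₁ δ₂ := by
  constructor
  · intro h ρ' hρ'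
    obtain ⟨r₀, h₀⟩ := h ρ' hρ' ρ' hρ'
    refine ⟨r₀, fun r hr N y hy c hl hv hT => h₀ r hr N y hy c hl hv hT ?_⟩
    intro c' _ hocc
    obtain ⟨i, hi⟩ := hocc
    refine ⟨i, by linarith, ?_⟩
    rw [coordMarker_zero]
    exact Finset.mem_univ i
  · exact coMarkedBandExclusionF_of_bandExclusionF _

/-- **SPARSE(m;δ) from one inequality (kernel B instantiated)**: a removal floor for `coordMarker m` at a rate `α` below a competitor
density `γ` gives SPARSE(m;δ) at every tolerance. -/
theorem sparse_of_floor {m : ℕ} {α D γ : ℝ} (hF : ChunkRemovalFloor (coordMarker m) α D) (hK : Competitor γ) (hαγ : α < γ)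
    (δ : ℝ) : UnmarkedChunkExclusionF (coordMarker m) δ :=
  unmarkedChunkExclusionF_of_floor hF hK hαγ δ

/-! ### §45.4 The cut of NLC_F(1) through the coordination marker (EXACT) -/

/-- **THE CUT OF NLC_F(1) THROUGH `coordMarker m` (EXACT, 0 EQUIV, every `m`)**: NLC_F(1) ⟺ SPARSE(m;1) ∧ COMARKED(m;1,2) ∧ NLC_F(2). -/
theorem noLooseChunksF_one_iff_coord (m : ℕ) :
    NoLooseChunksF 1 ↔ UnmarkedChunkExclusionF (coordMarker m) 1 ∧ CoMarkedBandExclusionF (coordMarker m) 1 2 ∧ NoLooseChunksF 2 :=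
  noLooseChunksF_iff_unmarked_comarked (coordMarker m) (by norm_num)

/-! ### §45.5 The first analytic input of the SPARSE floors, typed: separated shell sums (and the tree's crude constant) -/

/-- **`ShellSumBound s R S`** [GS-free · `N`-uniform · pure packing]: in every `s`-separated configuration, for every particle `a`,
`Σ_{b ≠ a, d_ab > R} d_ab⁻⁶ ≤ S`.  The removal floor of `coordMarker m` follows from it by one-centre bookkeeping at the rate
`α = (m−1)/24 + S/12 (+ boundary D·r²)` (bonded pairs `≤ m − 1` per unmarked particle at `V ≥ −1/12`; all other pairs at `V(d) ≥ −d⁻⁶/6`, the cross pairs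
counted twice) — which `(γ, S)` close which rung: the CONSTANTS LEDGER of the lens-1 g34 node header. -/
def ShellSumBound (s R S : ℝ) : Prop :=
  ∀ (N : ℕ) (y : Fin N → EuclideanSpace ℝ (Fin 3)), (∀ i j : Fin N, i ≠ j → s ≤ dist (y i) (y j)) →
    ∀ a : Fin N, ∑ b ∈ (Finset.univ.filter fun b : Fin N => b ≠ a ∧ R < dist (y a) (y b)), (dist (y a) (y b))⁻¹ ^ 6 ≤ S

/-- A shell-sum bound is monotone in the constant and in the inner radius. -/
theorem shellSumBound_mono {s R R' S S' : ℝ} (hR : R ≤ R') (hS : S ≤ S') (h : ShellSumBound s R S) : ShellSumBound s R' S' := by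
  intro N y hsep a
  refine le_trans (le_trans (Finset.sum_le_sum_of_subset_of_nonneg ?_ ?_) (h N y hsep a)) hS
  · intro b hb
    simp only [Finset.mem_filter, Finset.mem_univ, true_and] at hb ⊢
    exact ⟨hb.1, lt_of_le_of_lt hR hb.2⟩
  · intro b _ _
    positivity

/-- **The tree's crude instance**: `ShellSumBound s R (250·s⁻⁶)` for every `s > 0` and every `R` (`LennardJonesClusters.sum_inv_pow_six_le`; at `s = 7/10` the
constant is `≈ 2125` — the ledger's starting point, against the needed `S ≲ 3–6`). -/
theorem shellSumBound_crude {s : ℝ} (hs : 0 < s) (R : ℝ) : ShellSumBound s R (250 * s⁻¹ ^ 6) := by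
  intro N y hsep a
  refine le_trans (Finset.sum_le_sum_of_subset_of_nonneg ?_ ?_) (sum_inv_pow_six_le y hs hsep a)
  · intro b hb
    simp only [Finset.mem_filter, Finset.mem_univ, true_and] at hb
    exact Finset.mem_erase.mpr ⟨hb.1, Finset.mem_univ b⟩
  · intro b _ _
    positivity

end SparseCut45

end Summit.AtomisticToContinuum.Crystallization.Theorems.ContactSaturationLadderSparseCut
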